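import Literature.Geometry.Kaehler.ComplexTorusPicardNumberOneIsogenyClasses
import Literature.Geometry.Kaehler.ComplexTorusAbelianSurfaceEndomorphismAlgebras
import Literature.RingTheory.CentralSimple.AntiInvolutionSecondKindComplexModels
import HarnessLib

/-!
# The recursion `R_g ⊆ ⋃_{k∣g} {ρ(Aᵏ)} ∪ ⋃_n (R_n + R_{g−n})` of Hulek–Laface's algorithm, and the
# ranges `R_6 = {1,…,21,26,36}`, `R_7 = {1,…,22} ∪ {25,…,29} ∪ {37,49}`,
# `R_8 = {1,…,32} ∪ {34} ∪ {36,…,40} ∪ {50,64}`, `R_9 = {1,…,33} ∪ {35} ∪ {37,…,42} ∪ {45} ∪ {50,…,53} ∪ {65,81}`;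
# the endomorphism algebra of a simple abelian threefold is a field

Layer `Literature/Geometry/Kaehler`, namespace `Literature.Geometry.Kaehler.ComplexTorus`; lane
`lit-hodgefound`, Layer A4 (row A4-13).  Sequel of `ComplexTorusPicardNumberOneIsogenyClasses.lean`
(`R_4`, `R_5`, the additivity `{1, …, g} + R_h ⊆ R_{g+h}`, the isotypic-factor lemmas for dimension
`≤ 5`) and of `ComplexTorusAbelianSurfaceEndomorphismAlgebras.lean` (p12: `ρ(S) ∈ {1, 2, 3}` for a
simple abelian surface — Lange's table at `g = 2`) and of
`RingTheory/CentralSimple/AntiInvolutionSecondKindComplexModels.lean` (p12: complex models, giving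
`[F : K] = d²` for a central simple `F` over a number field `K`).

Source [HulekLaface2019PicardNumbersAV] K. Hulek, R. Laface, *On the Picard numbers of abelian
varieties*, Ann. Sc. Norm. Super. Pisa (2019), §6.2 «Computing `R_g` for small `g`» (held text
`paper:arxiv-1703.05882`, p0011–p0012), VERBATIM: "Let us consider `g ≥ 4` and suppose we know `R_{g'}`
for `g' < g`; then, we compute `R_g` as follows: (i) By Proposition 6.4, `R_g ⊃ {1, …, 2g−1}`. […]
(ii) Compute all possible Picard numbers of self-product abelian varieties `A^k`, where `dim A = g/k`.
[…] (iii) For every pair `(g_1, g_2)` such that `1 ≤ g_1 ≤ g_2 ≤ g−1` and `g_1 + g_2 = g`, compute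
`R_{g_1} + R_{g_2}`: these Picard numbers are obtained by considering non-simple abelian varieties.
(iv) Assemble everything in light of the following formula:
`R_g = ⋃_{k | g} {ρ(A^k) | A simple, dim A = g/k} ∪ ⋃_{1 ≤ n ≤ g−1} (R_n + R_{g−n})`."

## What is proved (theorems only; NO definition, NO named fact, net debt 0)

* §G1 **`IsAbelianVariety.finrank_neronSeveriGroup_mem_of_pow_of_add` — the formula of step (iv),
  inclusion `⊆`, in eliminator form**: a set `S ⊆ ℕ` containing `ρ(Xⁿ)` for every isotypic abelian
  variety `Xⁿ` (`X` simple) of dimension `g` and every sum `a + b`, `a ∈ R_m`, `b ∈ R_{g−m}`,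
  `1 ≤ m ≤ g−1`, contains `ρ(A)` for every abelian variety `A` of dimension `g ≥ 1`.  (Along a Poincaré
  decomposition `A ∼ ∏ X_ν^{n_ν}` either `r = 1` or `ρ(A) = ρ(X_0^{n_0}) + ρ(∏_{ν≠0} X_ν^{n_ν})` by
  Cor. 2.3, both factors abelian of complementary positive dimension.)  The reverse inclusion of (iv) is
  Prop. 6.1 (not formalised in general; the summands `{1, …, g}` are in the predecessor file).
* §G2 `IsSimple.finrank_neronSeveriGroup_pow_of_mul_finrank_le_eight`: the isotypic factors of
  dimension `m = n · dim X ∈ {6, 7, 8}` (step (ii)): `m = 6 ⇒ ρ ≤ 21 ∨ ρ = 36`;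
  `m = 7 ⇒ ρ ≤ 14 ∨ ρ ∈ {28, 49}`; `m = 8 ⇒ ρ ≤ 32 ∨ ρ ∈ {36, 64}` — from
  `ρ(Xⁿ) = nρ(X) + C(n,2)·dim_ℚ End_ℚ(X)` (Cor. 2.5), `1 ≤ ρ(X) ≤ dim_ℚ End_ℚ(X) ∣ 2 dim X`, `ρ(E) = 1`,
  and `ρ(S) ≤ 3` for simple abelian surfaces (`IsSimple.finrank_neronSeveriGroup_of_finrank_eq_two`).
* §G3 **`picardNumbers_six`**, **`picardNumbers_seven`**, **`picardNumbers_eight`**: the algorithm RUN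
  at `g = 6, 7, 8` as theorems — step (iv) (§G1) with `R_1, …, R_{g−1}` (tree: `picardNumbers_one`, …,
  `picardNumbers_five`) bounds `R_g` from above; the witnesses (Prop. 6.4's `{1, …, 2g}`, `R_{g−1} + 1`,
  Remark 6.5's products of elliptic curves `C(d+1,2) + Σ e_s²`, and `{1, …, g'} + R_h`) realise every
  member.  In particular `22, …, 25 ∉ R_6`; `23, 24 ∉ R_7` and the second gap `30, …, 36 ∉ R_7` of
  Thm. 1.1 (2) in its first dimension, with `29 = 2² + 5² ∈ R_7` attained; `33, 35 ∉ R_8`.  These VALUES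
  are the algorithm's output — the held text prints the algorithm and `R_1, R_2, R_3`, not the lists.

* §H1 **simple abelian THREEFOLDS** (Lange's §2.6.1 table at `g = 3`):
  `IsSimple.exists_sq_eq_finrank_centerField_endAlgRat` (`[F : K] = d²` is a square, from a complex model
  `F ⊗_σ ℂ ≅ M_d(ℂ)`, Thm. 2.6.8 Step I — for every simple complex torus),
  **`IsSimple.finrank_centerField_endAlgRat_eq_one_of_finrank_eq_three`** (Step I by counting at `g = 3`:
  `e d² ∣ 6 ⇒ d = 1`, so `End_ℚ(X) = K` is a FIELD for every simple complex torus of dimension `3`), and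
  **`IsSimple.finrank_neronSeveriGroup_of_finrank_eq_three`**: for a simple polarised threefold
  `(ρ(X), dim_ℚ End_ℚ(X)) ∈ {(1,1), (3,3)}` (type I: `K` totally real, `e ∣ 3`, `ρ = e`) `∪ {(1,2), (3,6)}`
  (type IV: `K` CM, `e₀ ∣ 3`, `ρ = e₀`).
* §H2 `IsSimple.finrank_neronSeveriGroup_pow_of_mul_finrank_eq_nine` (`m = 9 ⇒ ρ(Xⁿ) ≤ 18 ∨ ρ ∈ {27, 45, 81}`)
  and **`picardNumbers_nine : R_9 = {1,…,33} ∪ {35} ∪ {37,…,42} ∪ {45} ∪ {50,…,53} ∪ {65, 81}`** (so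
  `34, 36, 43, 44, 46, …, 49 ∉ R_9`, while `45 = 3² + 6²` is attained).

Not covered: `R_10` and beyond.  At `g = 10` the isotypic factor `S⁵` of a simple abelian surface `S`
contributes `5ρ(S) + 10·dim_ℚ End_ℚ(S)`, and the tree's classification of simple abelian surfaces
(`IsSimple.endAlgRat_trichotomy_of_finrank_eq_two`) still allows the type-III line `(ρ, dim) = (1, 4)`
(value `45`), which Shimura's theorem excludes for simple surfaces; `45 ∈ R_10` is undecided here.

## References

* [HulekLaface2019PicardNumbersAV] K. Hulek, R. Laface, *On the Picard numbers of abelian varieties*,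
  Ann. Sc. Norm. Super. Pisa (5) XIX (2019), §1 Thm. 1.1, §2.1 Cor. 2.3, §2.2 Cor. 2.5, §6.1 Prop. 6.1,
  §6.2 Prop. 6.4, Remark 6.5 and the algorithm (i)–(iv).
* [Lange2023AbelianVarietiesComplex] H. Lange, *Abelian Varieties over the Complex Numbers* (2023),
  §2.4.4 Thm. 2.4.25, §2.6.1 Proposition (table and proof, p. 139), §2.6.2 Thm. 2.6.5 Step I and
  Thm. 2.6.8, §5.1.5 Exercise (2)(b).
* [MumfordAV1970] D. Mumford, *Abelian Varieties* (1970), §21 Thm. 2 and table.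
-/

noncomputable section

open Module Matrix
open Complex (I ofReal)

namespace Literature.Geometry.Kaehler

namespace ComplexTorus

/-! ## §G1 The recursion (iv) of §6.2:
`R_g ⊆ ⋃_{k ∣ g} {ρ(Aᵏ) | A simple, dim A = g/k} ∪ ⋃_{1 ≤ n ≤ g−1} (R_n + R_{g−n})` -/

universe u

section Recursion

variable {E : Type u} [NormedAddCommGroup E] [NormedSpace ℂ E]

/-- The covering space of a complex torus is finite-dimensional over `ℂ`. [folklore] -/
private theorem finiteDimensional_complex_of_period₆ {ι : Type*} [Fintype ι] (Φ : (ι → ℝ) ≃L[ℝ] E) :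
    FiniteDimensional ℂ E := by
  haveI : FiniteDimensional ℝ E := LinearEquiv.finiteDimensional Φ.toLinearEquiv
  exact Module.Finite.of_restrictScalars_finite ℝ ℂ E

/-- **The recursion of §6.2, step (iv), inclusion `⊆`** ("assemble everything in light of the following
formula: `R_g = ⋃_{k | g} {ρ(A^k) | A simple, dim A = g/k} ∪ ⋃_{1 ≤ n ≤ g−1} (R_n + R_{g−n})`"), in
eliminator form: a set `S ⊆ ℕ` containing the Picard numbers `ρ(Xⁿ)` of all isotypic abelian varieties
`Xⁿ` (`X` simple) of dimension `g` and all sums `R_m + R_{g−m}`, `1 ≤ m ≤ g − 1`, contains `ρ(A)` for every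
abelian variety `A` of dimension `g ≥ 1`.  Proof: along a Poincaré decomposition `A ∼ ∏_ν X_ν^{n_ν}`
(pairwise non-isogenous simple `X_ν`) either `r = 1`, or `ρ(A) = ρ(X_0^{n_0}) + ρ(∏_{ν ≠ 0} X_ν^{n_ν})`
(Cor. 2.3) with both factors abelian of complementary positive dimensions.  (The reverse inclusion is
Prop. 6.1, not formalised in general.) [cite: HulekLaface2019PicardNumbersAV, §6.2 (algorithm, step (iv), displayed formula) with §2.1 Cor. 2.3] -/
theorem IsAbelianVariety.finrank_neronSeveriGroup_mem_of_pow_of_add {ι : Type*} [Fintype ι] [DecidableEq ι]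
    {A : (ι → ℝ) ≃L[ℝ] E} (hAV : IsAbelianVariety A) (hE : 0 < finrank ℂ E) (S : Set ℕ)
    (hpow : ∀ (κ : Type) [Fintype κ] [DecidableEq κ] [Nonempty κ] (F : Type u) [NormedAddCommGroup F]
      [NormedSpace ℂ F] (X : (κ → ℝ) ≃L[ℝ] F), IsSimple X → IsAbelianVariety X → ∀ n : ℕ, 0 < n →
        n * finrank ℂ F = finrank ℂ E → finrank ℤ (neronSeveriGroup (powPeriod X n)) ∈ S)
    (hadd : ∀ m, 0 < m → m < finrank ℂ E →
      ∀ a ∈ picardNumbers m, ∀ b ∈ picardNumbers (finrank ℂ E - m), a + b ∈ S) :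
    finrank ℤ (neronSeveriGroup A) ∈ S := by
  obtain ⟨ω, hω⟩ := hAV
  obtain ⟨r, V, hV, hVc, n, hVpos, hVs, hVab, hVV, hn, hiso⟩ := IsRiemannForm.exists_isIsogenous_powers_pos A hω
  haveI : ∀ ν, Nonempty (Fin (subRank (V ν))) := fun ν ↦ ⟨⟨0, hVpos ν⟩⟩
  set X : ∀ ν : Fin r, (Fin (subRank (V ν)) → ℝ) ≃L[ℝ] cxSpan A (V ν) :=
    fun ν ↦ subtorusPeriod A (V ν) (hV ν) (hVc ν) with hXdef
  haveI : ∀ ν, FiniteDimensional ℂ (cxSpan A (V ν)) := fun ν ↦ finiteDimensional_complex_of_period₆ (X ν)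
  have hsum : ∑ ν, n ν * finrank ℂ (cxSpan A (V ν)) = finrank ℂ E := by
    rw [← finrank_powers_eq X n, ← hiso.finrank_eq _ _]
  have hm1 : ∀ ν, 1 ≤ n ν * finrank ℂ (cxSpan A (V ν)) := fun ν ↦
    Nat.mul_pos (hn ν) (finrank_pos_of_nonempty (X ν))
  have hρ : finrank ℤ (neronSeveriGroup A) = ∑ ν, finrank ℤ (neronSeveriGroup (powPeriod (X ν) (n ν))) := by
    rw [hiso.finrank_neronSeveriGroup_eq _ _, finrank_neronSeveriGroup_powers X n hVs hVab hVV]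
  rcases Nat.lt_or_ge r 2 with hr | hr
  · interval_cases r
    · simp at hsum
      omega
    · rw [Fin.sum_univ_one] at hsum hρ
      rw [hρ]
      exact hpow _ _ (X 0) (hVs 0) (hVab 0) (n 0) (hn 0) hsum
  · -- split off the isotypic component `ν₀ = 0`
    set ν₀ : Fin r := ⟨0, by omega⟩ with hν₀
    have hsplit : ∀ f : Fin r → ℕ, ∑ ν, f ν = f ν₀ + ∑ t : {ν : Fin r // ν ≠ ν₀}, f t.1 := fun f ↦ by
      rw [← Finset.add_sum_erase _ _ (Finset.mem_univ ν₀), Finset.sum_subtype (Finset.univ.erase ν₀)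
        (p := fun ν ↦ ν ≠ ν₀) (fun ν ↦ by simp)]
    -- the complementary product `∏_{ν ≠ ν₀} X_ν^{n_ν}`
    have hTρ : finrank ℤ (neronSeveriGroup (sigmaPiPeriod fun t : {ν : Fin r // ν ≠ ν₀} ↦ powPeriod (X t.1) (n t.1))) =
        ∑ t : {ν : Fin r // ν ≠ ν₀}, finrank ℤ (neronSeveriGroup (powPeriod (X t.1) (n t.1))) :=
      finrank_neronSeveriGroup_powers (fun t : {ν : Fin r // ν ≠ ν₀} ↦ X t.1) (fun t ↦ n t.1) (fun t ↦ hVs t.1)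
        (fun t ↦ hVab t.1) fun t t' htt' ↦ hVV t.1 t'.1 fun h ↦ htt' (Subtype.ext h)
    have hTab : IsAbelianVariety (sigmaPiPeriod fun t : {ν : Fin r // ν ≠ ν₀} ↦ powPeriod (X t.1) (n t.1)) :=
      IsAbelianVariety.sigmaPi fun t ↦ (hVab t.1).pow (n t.1)
    have hTdim : finrank ℂ (∀ t : {ν : Fin r // ν ≠ ν₀}, Fin (n t.1) → cxSpan A (V t.1)) =
        ∑ t : {ν : Fin r // ν ≠ ν₀}, n t.1 * finrank ℂ (cxSpan A (V t.1)) :=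
      finrank_powers_eq (fun t : {ν : Fin r // ν ≠ ν₀} ↦ X t.1) fun t ↦ n t.1
    -- dimensions: `m₀ + (g − m₀) = g` with `1 ≤ m₀ ≤ g − 1`
    have hν₁ : (⟨1, by omega⟩ : Fin r) ≠ ν₀ := by simp [hν₀, Fin.ext_iff]
    have hrest : 1 ≤ ∑ t : {ν : Fin r // ν ≠ ν₀}, n t.1 * finrank ℂ (cxSpan A (V t.1)) :=
      le_trans (hm1 _) (Finset.single_le_sum (f := fun t : {ν : Fin r // ν ≠ ν₀} ↦
        n t.1 * finrank ℂ (cxSpan A (V t.1))) (fun t _ ↦ Nat.zero_le _) (Finset.mem_univ ⟨_, hν₁⟩))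
    rw [hsplit] at hsum
    have h0 := hm1 ν₀
    have hmem₁ : finrank ℤ (neronSeveriGroup (powPeriod (X ν₀) (n ν₀))) ∈
        picardNumbers (n ν₀ * finrank ℂ (cxSpan A (V ν₀))) := by
      have h := ((hVab ν₀).pow (n ν₀)).mem_picardNumbers
      rwa [Module.finrank_pi_fintype, Finset.sum_const, Finset.card_univ, Fintype.card_fin, smul_eq_mul] at h
    have hmem₂ : finrank ℤ (neronSeveriGroup
        (sigmaPiPeriod fun t : {ν : Fin r // ν ≠ ν₀} ↦ powPeriod (X t.1) (n t.1))) ∈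
        picardNumbers (finrank ℂ E - n ν₀ * finrank ℂ (cxSpan A (V ν₀))) := by
      have h := hTab.mem_picardNumbers
      rwa [hTdim, show ∑ t : {ν : Fin r // ν ≠ ν₀}, n t.1 * finrank ℂ (cxSpan A (V t.1)) =
        finrank ℂ E - n ν₀ * finrank ℂ (cxSpan A (V ν₀)) by omega] at h
    rw [hρ, hsplit, ← hTρ]
    exact hadd _ h0 (by omega) _ hmem₁ _ hmem₂

end Recursion

/-! ## §G2 Isotypic factors of dimension `6`, `7`, `8` -/

section Parts

variable {E : Type*} [NormedAddCommGroup E] [NormedSpace ℂ E]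

/-- The covering space of a complex torus is finite-dimensional over `ℂ`. [folklore] -/
private theorem finiteDimensional_complex_of_period₇ {ι : Type*} [Fintype ι] (Φ : (ι → ℝ) ≃L[ℝ] E) :
    FiniteDimensional ℂ E := by
  haveI : FiniteDimensional ℝ E := LinearEquiv.finiteDimensional Φ.toLinearEquiv
  exact Module.Finite.of_restrictScalars_finite ℝ ℂ E

/-- **Isotypic factors of dimension `6`, `7`, `8`** (`X` simple abelian, `m = n · dim X`):
`m = 6 ⇒ ρ(Xⁿ) ≤ 21 ∨ ρ = 36`; `m = 7 ⇒ ρ ≤ 14 ∨ ρ ∈ {28, 49}`; `m = 8 ⇒ ρ ≤ 32 ∨ ρ ∈ {36, 64}` — from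
`ρ(Xⁿ) = nρ(X) + C(n,2)e`, `1 ≤ ρ(X) ≤ e ∣ 2 dim X`, `ρ(E) = 1`, and `ρ(S) ≤ 3` for a simple abelian
SURFACE (Lange's table at `g = 2`: the cases `(dim X, n) = (2, 3), (2, 4)`).
[cite: HulekLaface2019PicardNumbersAV, §6.2 (algorithm (ii)) with §2.2 Cor. 2.5] [cite: Lange2023AbelianVarietiesComplex, §2.6.1 Proposition (table, column `ρ`) with §5.1.5 Exercise (2)(b)] -/
theorem IsSimple.finrank_neronSeveriGroup_pow_of_mul_finrank_le_eight {ι : Type} [Fintype ι] [DecidableEq ι]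
    [Nonempty ι] {X : (ι → ℝ) ≃L[ℝ] E} (hX : IsSimple X) (hA : IsAbelianVariety X) {n : ℕ} (hn : 0 < n) :
    (n * finrank ℂ E = 6 → finrank ℤ (neronSeveriGroup (powPeriod X n)) ≤ 21 ∨
        finrank ℤ (neronSeveriGroup (powPeriod X n)) = 36) ∧
      (n * finrank ℂ E = 7 → finrank ℤ (neronSeveriGroup (powPeriod X n)) ≤ 14 ∨
        finrank ℤ (neronSeveriGroup (powPeriod X n)) = 28 ∨ finrank ℤ (neronSeveriGroup (powPeriod X n)) = 49) ∧
      (n * finrank ℂ E = 8 → finrank ℤ (neronSeveriGroup (powPeriod X n)) ≤ 32 ∨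
        finrank ℤ (neronSeveriGroup (powPeriod X n)) = 36 ∨ finrank ℤ (neronSeveriGroup (powPeriod X n)) = 64) := by
  haveI : FiniteDimensional ℂ E := finiteDimensional_complex_of_period₇ X
  have hρn : finrank ℤ (neronSeveriGroup (powPeriod X n)) =
      n * finrank ℤ (neronSeveriGroup X) + n.choose 2 * finrank ℚ (endAlgRat X) :=
    hA.finrank_neronSeveriGroup_pow n
  have hpe : finrank ℤ (neronSeveriGroup X) ≤ finrank ℚ (endAlgRat X) :=
    hA.finrank_neronSeveriGroup_le_finrank_endAlgRat
  have hed : finrank ℚ (endAlgRat X) ∣ 2 * finrank ℂ E := hX.finrank_endAlgRat_dvd_two_mul_finrank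
  have he1 : 1 ≤ finrank ℚ (endAlgRat X) := one_le_finrank_endAlgRat X
  have hp1 : finrank ℂ E = 1 → finrank ℤ (neronSeveriGroup X) = 1 := fun h ↦
    finrank_neronSeveriGroup_eq_one_of_finrank_eq_one X h
  have hp3 : finrank ℂ E = 2 → finrank ℤ (neronSeveriGroup X) ≤ 3 := fun h ↦ by
    obtain ⟨η, hη⟩ := hA
    rcases hX.finrank_neronSeveriGroup_of_finrank_eq_two hη h with h' | h' | h' <;> omega
  have hdpos : 0 < finrank ℂ E := finrank_pos_of_nonempty X
  set p := finrank ℤ (neronSeveriGroup X) with hp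
  set e := finrank ℚ (endAlgRat X) with he
  set d := finrank ℂ E with hd
  rw [hρn]
  refine ⟨fun hm ↦ ?_, fun hm ↦ ?_, fun hm ↦ ?_⟩
  · have hn6 : n ≤ 6 := by nlinarith
    interval_cases n
    · have hd6 : d = 6 := by omega
      rw [hd6] at hed
      have := Nat.le_of_dvd (by norm_num) hed
      simp only [one_mul, show Nat.choose 1 2 = 0 by decide, zero_mul, add_zero]
      omega
    · have hd3 : d = 3 := by omega
      rw [hd3] at hed
      have := Nat.le_of_dvd (by norm_num) hed
      simp only [show Nat.choose 2 2 = 1 by decide, one_mul]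
      omega
    · have hd2 : d = 2 := by omega
      have h3 := hp3 hd2
      rw [hd2] at hed
      have := Nat.le_of_dvd (by norm_num) hed
      simp only [show Nat.choose 3 2 = 3 by decide]
      omega
    · omega
    · omega
    · have hd1 : d = 1 := by omega
      rw [hd1] at hed
      have h2 := Nat.le_of_dvd (by norm_num) hed
      have h1 := hp1 hd1
      simp only [show Nat.choose 6 2 = 15 by decide]
      interval_cases e <;> omega
  · have hn7 : n ≤ 7 := by nlinarith
    interval_cases n
    · have hd7 : d = 7 := by omega
      rw [hd7] at hed
      have := Nat.le_of_dvd (by norm_num) hed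
      simp only [one_mul, show Nat.choose 1 2 = 0 by decide, zero_mul, add_zero]
      omega
    · omega
    · omega
    · omega
    · omega
    · omega
    · have hd1 : d = 1 := by omega
      rw [hd1] at hed
      have h2 := Nat.le_of_dvd (by norm_num) hed
      have h1 := hp1 hd1
      simp only [show Nat.choose 7 2 = 21 by decide]
      interval_cases e <;> omega
  · have hn8 : n ≤ 8 := by nlinarith
    interval_cases n
    · have hd8 : d = 8 := by omega
      rw [hd8] at hed
      have := Nat.le_of_dvd (by norm_num) hed
      simp only [one_mul, show Nat.choose 1 2 = 0 by decide, zero_mul, add_zero]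
      omega
    · have hd4 : d = 4 := by omega
      rw [hd4] at hed
      have := Nat.le_of_dvd (by norm_num) hed
      simp only [show Nat.choose 2 2 = 1 by decide, one_mul]
      omega
    · omega
    · have hd2 : d = 2 := by omega
      have h3 := hp3 hd2
      rw [hd2] at hed
      have h4 := Nat.le_of_dvd (by norm_num) hed
      simp only [show Nat.choose 4 2 = 6 by decide]
      interval_cases e <;> omega
    · omega
    · omega
    · omega
    · have hd1 : d = 1 := by omega
      rw [hd1] at hed
      have h2 := Nat.le_of_dvd (by norm_num) hed
      have h1 := hp1 hd1
      simp only [show Nat.choose 8 2 = 28 by decide]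
      interval_cases e <;> omega

end Parts

/-! ## §G3 `R_6`, `R_7`, `R_8` -/

section SixSevenEight

/-- **`R_6 = {1, …, 21, 26, 36}`** — the algorithm of §6.2 at `g = 6` (step (iv) with `R_1, …, R_5` and the
isotypic factors of dimension `6`; witnesses: `{1, …, 12}` (Prop. 6.4), `13, 14, 16, 18, 26 ∈ R_5 + 1`,
`15 = C(4,2) + 3²`, `17 = 4² + 1`, `19 = C(3,2) + 4²`, `20 = 4² + 2²`, `21 = C(7,2)`, `36 = 6²`).  The value
is the algorithm's output (not printed in the held text). [cite: HulekLaface2019PicardNumbersAV, §6.2 (algorithm (i)–(iv)) with Prop. 6.4 and Remark 6.5] -/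
theorem picardNumbers_six : picardNumbers 6 = Set.Icc 1 21 ∪ {26, 36} := by
  ext x
  constructor
  · intro hx
    have hx36 := picardNumbers_subset_Icc (by norm_num : 1 ≤ 6) hx
    rw [Set.mem_Icc] at hx36
    obtain ⟨A, hA, rfl⟩ := hx
    have hS := hA.finrank_neronSeveriGroup_mem_of_pow_of_add (by rw [Module.finrank_fin_fun]; norm_num)
      {y | y ≤ 21 ∨ y = 26 ∨ y = 36} (fun κ _ _ _ F _ _ X hX hXab n hn hm ↦ by
        rw [Module.finrank_fin_fun] at hm
        rcases (hX.finrank_neronSeveriGroup_pow_of_mul_finrank_le_eight hXab hn).1 hm with h | h <;>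
          simp only [Set.mem_setOf_eq] <;> omega)
      (fun m hm0 hm6 a ha b hb ↦ by
        rw [Module.finrank_fin_fun] at hm6 hb
        simp only [Set.mem_setOf_eq]
        interval_cases m
        · rw [picardNumbers_one] at ha; rw [picardNumbers_five] at hb
          simp only [Set.mem_singleton_iff, Set.mem_union, Set.mem_Icc, Set.mem_insert_iff] at ha hb; omega
        · rw [picardNumbers_two] at ha; rw [picardNumbers_four] at hb
          simp only [Set.mem_singleton_iff, Set.mem_union, Set.mem_Icc, Set.mem_insert_iff] at ha hb; omega
        · rw [picardNumbers_three] at ha hb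
          simp only [Set.mem_singleton_iff, Set.mem_union, Set.mem_Icc] at ha hb; omega
        · rw [picardNumbers_four] at ha; rw [picardNumbers_two] at hb
          simp only [Set.mem_singleton_iff, Set.mem_union, Set.mem_Icc, Set.mem_insert_iff] at ha hb; omega
        · rw [picardNumbers_five] at ha; rw [picardNumbers_one] at hb
          simp only [Set.mem_singleton_iff, Set.mem_union, Set.mem_Icc, Set.mem_insert_iff] at ha hb; omega)
    simp only [Set.mem_setOf_eq] at hS
    simp only [Set.mem_union, Set.mem_Icc, Set.mem_insert_iff, Set.mem_singleton_iff]
    omega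
  · rintro (hx | hx | hx)
    · rw [Set.mem_Icc] at hx
      rcases Nat.lt_or_ge x 13 with h12 | h13
      · exact Icc_one_two_mul_subset_picardNumbers (g := 6) (by norm_num) (Set.mem_Icc.2 ⟨hx.1, by omega⟩)
      · have hsucc : ∀ y ∈ picardNumbers 5, y + 1 ∈ picardNumbers 6 := fun y hy ↦
          image_succ_picardNumbers_subset 5 ⟨y, hy, rfl⟩
        have hR5 : ∀ y, y ∈ Set.Icc 1 13 ∪ ({15, 17, 25} : Set ℕ) → y ∈ picardNumbers 5 := fun y hy ↦ by
          rw [picardNumbers_five]; exact hy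
        rcases (show x = 13 ∨ x = 14 ∨ x = 15 ∨ x = 16 ∨ x = 17 ∨ x = 18 ∨ x = 19 ∨ x = 20 ∨ x = 21 by omega)
          with rfl | rfl | rfl | rfl | rfl | rfl | rfl | rfl | rfl
        · exact hsucc 12 (hR5 12 (by simp))
        · exact hsucc 13 (hR5 13 (by simp))
        · simpa [show Nat.choose 4 2 = 6 by decide] using
            choose_add_sum_sq_mem_picardNumbers (S := Unit) (fun _ ↦ 3) 3
        · exact hsucc 15 (hR5 15 (by simp))
        · simpa using sq_add_one_mem_picardNumbers_add (k := 2) (by norm_num) 4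
        · exact hsucc 17 (hR5 17 (by simp))
        · simpa [show Nat.choose 3 2 = 3 by decide] using
            choose_add_sum_sq_mem_picardNumbers (S := Unit) (fun _ ↦ 4) 2
        · simpa using choose_add_sum_sq_mem_picardNumbers (S := Bool) (fun b ↦ cond b 4 2) 0
        · simpa [show Nat.choose 7 2 = 21 by decide] using
            choose_add_sum_sq_mem_picardNumbers (S := Fin 0) (fun i ↦ i.elim0) 6
    · subst hx
      simpa using sq_add_one_mem_picardNumbers_add (k := 1) le_rfl 5
    · rw [Set.mem_singleton_iff] at hx
      subst hx
      simpa using choose_add_sum_sq_mem_picardNumbers (S := Unit) (fun _ ↦ 6) 0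

/-- **`R_7 = {1, …, 22} ∪ {25, …, 29} ∪ {37, 49}`** — the algorithm of §6.2 at `g = 7` (step (iv) with
`R_1, …, R_6`; witnesses: `{1, …, 14}` (Prop. 6.4), `15, …, 22, 27, 37 ∈ R_6 + 1`, `25 = 3² + 4²`,
`26 = 5² + 1`, `28 = C(8,2)`, `29 = 2² + 5²`, `49 = 7²`). In particular `23, 24 ∉ R_7` and the second gap
`30, …, 36 ∉ R_7` of Thm. 1.1 (2) at its first dimension. [cite: HulekLaface2019PicardNumbersAV, §6.2 (algorithm (i)–(iv)) with Prop. 6.4, Remark 6.5 and §1 Thm. 1.1 (2)] -/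
theorem picardNumbers_seven : picardNumbers 7 = Set.Icc 1 22 ∪ Set.Icc 25 29 ∪ {37, 49} := by
  ext x
  constructor
  · intro hx
    have hx49 := picardNumbers_subset_Icc (by norm_num : 1 ≤ 7) hx
    rw [Set.mem_Icc] at hx49
    obtain ⟨A, hA, rfl⟩ := hx
    have hS := hA.finrank_neronSeveriGroup_mem_of_pow_of_add (by rw [Module.finrank_fin_fun]; norm_num)
      {y | y ≤ 22 ∨ (25 ≤ y ∧ y ≤ 29) ∨ y = 37 ∨ y = 49} (fun κ _ _ _ F _ _ X hX hXab n hn hm ↦ by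
        rw [Module.finrank_fin_fun] at hm
        rcases (hX.finrank_neronSeveriGroup_pow_of_mul_finrank_le_eight hXab hn).2.1 hm with h | h | h <;>
          simp only [Set.mem_setOf_eq] <;> omega)
      (fun m hm0 hm7 a ha b hb ↦ by
        rw [Module.finrank_fin_fun] at hm7 hb
        simp only [Set.mem_setOf_eq]
        interval_cases m
        · rw [picardNumbers_one] at ha; rw [picardNumbers_six] at hb
          simp only [Set.mem_singleton_iff, Set.mem_union, Set.mem_Icc, Set.mem_insert_iff] at ha hb; omega
        · rw [picardNumbers_two] at ha; rw [picardNumbers_five] at hb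
          simp only [Set.mem_singleton_iff, Set.mem_union, Set.mem_Icc, Set.mem_insert_iff] at ha hb; omega
        · rw [picardNumbers_three] at ha; rw [picardNumbers_four] at hb
          simp only [Set.mem_singleton_iff, Set.mem_union, Set.mem_Icc, Set.mem_insert_iff] at ha hb; omega
        · rw [picardNumbers_four] at ha; rw [picardNumbers_three] at hb
          simp only [Set.mem_singleton_iff, Set.mem_union, Set.mem_Icc, Set.mem_insert_iff] at ha hb; omega
        · rw [picardNumbers_five] at ha; rw [picardNumbers_two] at hb
          simp only [Set.mem_singleton_iff, Set.mem_union, Set.mem_Icc, Set.mem_insert_iff] at ha hb; omega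
        · rw [picardNumbers_six] at ha; rw [picardNumbers_one] at hb
          simp only [Set.mem_singleton_iff, Set.mem_union, Set.mem_Icc, Set.mem_insert_iff] at ha hb; omega)
    simp only [Set.mem_setOf_eq] at hS
    simp only [Set.mem_union, Set.mem_Icc, Set.mem_insert_iff, Set.mem_singleton_iff]
    omega
  · have hsucc : ∀ y ∈ picardNumbers 6, y + 1 ∈ picardNumbers 7 := fun y hy ↦
      image_succ_picardNumbers_subset 6 ⟨y, hy, rfl⟩
    have hR6 : ∀ y, y ∈ Set.Icc 1 21 ∪ ({26, 36} : Set ℕ) → y ∈ picardNumbers 6 := fun y hy ↦ by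
      rw [picardNumbers_six]; exact hy
    rintro ((hx | hx) | hx)
    · rw [Set.mem_Icc] at hx
      rcases Nat.lt_or_ge x 15 with h14 | h15
      · exact Icc_one_two_mul_subset_picardNumbers (g := 7) (by norm_num) (Set.mem_Icc.2 ⟨hx.1, by omega⟩)
      · have h := hsucc (x - 1) (hR6 (x - 1) (Or.inl (Set.mem_Icc.2 ⟨by omega, by omega⟩)))
        rwa [show x - 1 + 1 = x by omega] at h
    · rw [Set.mem_Icc] at hx
      rcases (show x = 25 ∨ x = 26 ∨ x = 27 ∨ x = 28 ∨ x = 29 by omega) with rfl | rfl | rfl | rfl | rfl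
      · simpa using choose_add_sum_sq_mem_picardNumbers (S := Bool) (fun b ↦ cond b 3 4) 0
      · simpa using sq_add_one_mem_picardNumbers_add (k := 2) (by norm_num) 5
      · exact hsucc 26 (hR6 26 (by simp))
      · simpa [show Nat.choose 8 2 = 28 by decide] using
          choose_add_sum_sq_mem_picardNumbers (S := Fin 0) (fun i ↦ i.elim0) 7
      · simpa using choose_add_sum_sq_mem_picardNumbers (S := Bool) (fun b ↦ cond b 2 5) 0
    · rcases hx with rfl | hx
      · exact hsucc 36 (hR6 36 (by simp))
      · rw [Set.mem_singleton_iff] at hx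
        subst hx
        simpa using choose_add_sum_sq_mem_picardNumbers (S := Unit) (fun _ ↦ 7) 0

/-- **`R_8 = {1, …, 32} ∪ {34} ∪ {36, …, 40} ∪ {50, 64}`** — the algorithm of §6.2 at `g = 8` (step (iv)
with `R_1, …, R_7`; witnesses: `{1, …, 16}` (Prop. 6.4), `R_7 + 1`, `24 = 2² + 2² + 4²`, `25 = C(7,2) + 2²`,
`31 = C(4,2) + 5²`, `32 = 4² + 4²`, `34 = 3² + 5²`, `36 = C(9,2)`, `37 = 1 + 36 ∈ {1, 2} + R_6`,
`39 = C(3,2) + 6²`, `40 = 6² + 2²`, `50 = 7² + 1`, `64 = 8²`). In particular `33, 35 ∉ R_8`.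
[cite: HulekLaface2019PicardNumbersAV, §6.2 (algorithm (i)–(iv)) with Prop. 6.4, Remark 6.5 and §1 Thm. 1.1] -/
theorem picardNumbers_eight :
    picardNumbers 8 = Set.Icc 1 32 ∪ {34} ∪ Set.Icc 36 40 ∪ {50, 64} := by
  ext x
  constructor
  · intro hx
    have hx64 := picardNumbers_subset_Icc (by norm_num : 1 ≤ 8) hx
    rw [Set.mem_Icc] at hx64
    obtain ⟨A, hA, rfl⟩ := hx
    have hS := hA.finrank_neronSeveriGroup_mem_of_pow_of_add (by rw [Module.finrank_fin_fun]; norm_num)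
      {y | y ≤ 32 ∨ y = 34 ∨ (36 ≤ y ∧ y ≤ 40) ∨ y = 50 ∨ y = 64} (fun κ _ _ _ F _ _ X hX hXab n hn hm ↦ by
        rw [Module.finrank_fin_fun] at hm
        rcases (hX.finrank_neronSeveriGroup_pow_of_mul_finrank_le_eight hXab hn).2.2 hm with h | h | h <;>
          simp only [Set.mem_setOf_eq] <;> omega)
      (fun m hm0 hm8 a ha b hb ↦ by
        rw [Module.finrank_fin_fun] at hm8 hb
        simp only [Set.mem_setOf_eq]
        interval_cases m
        · rw [picardNumbers_one] at ha; rw [picardNumbers_seven] at hb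
          simp only [Set.mem_singleton_iff, Set.mem_union, Set.mem_Icc, Set.mem_insert_iff] at ha hb; omega
        · rw [picardNumbers_two] at ha; rw [picardNumbers_six] at hb
          simp only [Set.mem_singleton_iff, Set.mem_union, Set.mem_Icc, Set.mem_insert_iff] at ha hb; omega
        · rw [picardNumbers_three] at ha; rw [picardNumbers_five] at hb
          simp only [Set.mem_singleton_iff, Set.mem_union, Set.mem_Icc, Set.mem_insert_iff] at ha hb; omega
        · rw [picardNumbers_four] at ha hb
          simp only [Set.mem_singleton_iff, Set.mem_union, Set.mem_Icc, Set.mem_insert_iff] at ha hb; omega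
        · rw [picardNumbers_five] at ha; rw [picardNumbers_three] at hb
          simp only [Set.mem_singleton_iff, Set.mem_union, Set.mem_Icc, Set.mem_insert_iff] at ha hb; omega
        · rw [picardNumbers_six] at ha; rw [picardNumbers_two] at hb
          simp only [Set.mem_singleton_iff, Set.mem_union, Set.mem_Icc, Set.mem_insert_iff] at ha hb; omega
        · rw [picardNumbers_seven] at ha; rw [picardNumbers_one] at hb
          simp only [Set.mem_singleton_iff, Set.mem_union, Set.mem_Icc, Set.mem_insert_iff] at ha hb; omega)
    simp only [Set.mem_setOf_eq] at hS
    simp only [Set.mem_union, Set.mem_Icc, Set.mem_insert_iff, Set.mem_singleton_iff]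
    omega
  · have hsucc : ∀ y ∈ picardNumbers 7, y + 1 ∈ picardNumbers 8 := fun y hy ↦
      image_succ_picardNumbers_subset 7 ⟨y, hy, rfl⟩
    have hR7 : ∀ y, y ∈ Set.Icc 1 22 ∪ Set.Icc 25 29 ∪ ({37, 49} : Set ℕ) → y ∈ picardNumbers 7 :=
      fun y hy ↦ by rw [picardNumbers_seven]; exact hy
    rintro (((hx | hx) | hx) | hx)
    · rw [Set.mem_Icc] at hx
      rcases Nat.lt_or_ge x 17 with h16 | h17
      · exact Icc_one_two_mul_subset_picardNumbers (g := 8) (by norm_num) (Set.mem_Icc.2 ⟨hx.1, by omega⟩)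
      · rcases Nat.lt_or_ge x 24 with h23 | h24
        · have h := hsucc (x - 1) (hR7 (x - 1) (Or.inl (Or.inl (Set.mem_Icc.2 ⟨by omega, by omega⟩))))
          rwa [show x - 1 + 1 = x by omega] at h
        · rcases Nat.lt_or_ge x 26 with h25 | h26
          · rcases (show x = 24 ∨ x = 25 by omega) with rfl | rfl
            · simpa [Fin.sum_univ_three] using
                choose_add_sum_sq_mem_picardNumbers (S := Fin 3) ![2, 2, 4] 0
            · simpa [show Nat.choose 7 2 = 21 by decide] using
                choose_add_sum_sq_mem_picardNumbers (S := Unit) (fun _ ↦ 2) 6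
          · rcases Nat.lt_or_ge x 31 with h30 | h31
            · have h := hsucc (x - 1) (hR7 (x - 1) (Or.inl (Or.inr (Set.mem_Icc.2 ⟨by omega, by omega⟩))))
              rwa [show x - 1 + 1 = x by omega] at h
            · rcases (show x = 31 ∨ x = 32 by omega) with rfl | rfl
              · simpa [show Nat.choose 4 2 = 6 by decide] using
                  choose_add_sum_sq_mem_picardNumbers (S := Unit) (fun _ ↦ 5) 3
              · simpa using choose_add_sum_sq_mem_picardNumbers (S := Bool) (fun _ ↦ 4) 0
    · rw [Set.mem_singleton_iff] at hx
      subst hx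
      simpa using choose_add_sum_sq_mem_picardNumbers (S := Bool) (fun b ↦ cond b 3 5) 0
    · rw [Set.mem_Icc] at hx
      rcases (show x = 36 ∨ x = 37 ∨ x = 38 ∨ x = 39 ∨ x = 40 by omega) with rfl | rfl | rfl | rfl | rfl
      · simpa [show Nat.choose 9 2 = 36 by decide] using
          choose_add_sum_sq_mem_picardNumbers (S := Fin 0) (fun i ↦ i.elim0) 8
      · have h36 : 36 ∈ picardNumbers 6 := by rw [picardNumbers_six]; simp
        simpa using add_mem_picardNumbers_of_le (g := 2) h36 (k := 1) le_rfl (by norm_num)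
      · exact hsucc 37 (hR7 37 (by simp))
      · simpa [show Nat.choose 3 2 = 3 by decide] using
          choose_add_sum_sq_mem_picardNumbers (S := Unit) (fun _ ↦ 6) 2
      · simpa using choose_add_sum_sq_mem_picardNumbers (S := Bool) (fun b ↦ cond b 6 2) 0
    · rcases hx with rfl | hx
      · simpa using sq_add_one_mem_picardNumbers_add (k := 1) le_rfl 7
      · rw [Set.mem_singleton_iff] at hx
        subst hx
        simpa using choose_add_sum_sq_mem_picardNumbers (S := Unit) (fun _ ↦ 8) 0

end SixSevenEight



/-! ## §H1 Simple abelian threefolds: `End_ℚ(X) = K` is a field, `(ρ, [K:ℚ]) ∈ {(1,1), (3,3), (1,2), (3,6)}` -/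

section Threefold

open NumberField

variable {κ : Type} [Fintype κ] [DecidableEq κ] [Nonempty κ] {E : Type*} [NormedAddCommGroup E]
  [NormedSpace ℂ E] {Ψ : (κ → ℝ) ≃L[ℝ] E} {η : E [⋀^Fin 2]→L[ℝ] ℝ}

/-- `ℚ ⊆ K ⊆ End_ℚ(X)` is a scalar tower. [folklore] -/
private theorem isScalarTower_rat₃ (hX : IsSimple Ψ) :
    IsScalarTower ℚ (centerField Ψ hX) (endAlgRat Ψ) :=
  IsScalarTower.of_algebraMap_smul fun q x ↦ by
    rw [Algebra.smul_def, Algebra.algebraMap_eq_smul_one q,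
      map_rat_smul (algebraMap (centerField Ψ hX) (endAlgRat Ψ)) q 1, map_one, smul_mul_assoc, one_mul]

/-- `End_ℚ(X)` is a non-trivial ring. [folklore] -/
private theorem nontrivial_endAlgRat₃ (Ψ : (κ → ℝ) ≃L[ℝ] E) : Nontrivial (endAlgRat Ψ) :=
  ⟨⟨0, 1, fun h ↦ zero_ne_one (congrArg Subtype.val h)⟩⟩

/-- **`[F : K] = d²` is a perfect square** for the skew field `F = End_ℚ(X)` of a simple complex torus over
its centre `K` ("`[F : K] = d²`", the degree of the central simple algebra `F`; here read off a complex
model `F ⊗_σ ℂ ≅ M_d(ℂ)`, Thm. 2.6.8 Step I). [cite: Lange2023AbelianVarietiesComplex, §2.6.1 Proposition, proof (p0139 L1–L3: "`dim_ℚ F = ed²`") with §2.6.2 Thm. 2.6.8 Step I] -/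
theorem IsSimple.exists_sq_eq_finrank_centerField_endAlgRat (hX : IsSimple Ψ) :
    ∃ d : ℕ, d ^ 2 = finrank (centerField Ψ hX) (endAlgRat Ψ) := by
  haveI := isScalarTower_rat₃ hX
  haveI := nontrivial_endAlgRat₃ Ψ
  haveI : IsSimpleRing (endAlgRat Ψ) := by letI := hX.divisionRing; infer_instance
  haveI : Module.Finite (centerField Ψ hX) (endAlgRat Ψ) :=
    Module.Finite.of_restrictScalars_finite ℚ (centerField Ψ hX) (endAlgRat Ψ)
  obtain ⟨σ⟩ : Nonempty (centerField Ψ hX →+* ℂ) := by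
    rw [← Fintype.card_pos_iff, Embeddings.card]
    exact finrank_pos
  obtain ⟨d, j, hj⟩ := Literature.RingTheory.CentralSimple.exists_isComplexModel (centerField Ψ hX) σ
    (F := endAlgRat Ψ)
  exact ⟨d, hj.sq_eq⟩

variable [FiniteDimensional ℂ E]

/-- **Step I by counting, `g = 3`: `[F : K] = 1`** — for a simple complex torus of dimension `3`,
`e·d² = [F : ℚ] ∣ 2g = 6` with `[F : K] = d²` a square forces `d = 1`: `End_ℚ(X) = K` is commutative.
[cite: Lange2023AbelianVarietiesComplex, §2.6.1 Proposition, proof (p0139 L1–L3) and table («restriction» column with `g = 3`)] -/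
theorem IsSimple.finrank_centerField_endAlgRat_eq_one_of_finrank_eq_three (hX : IsSimple Ψ)
    (hg : finrank ℂ E = 3) : finrank (centerField Ψ hX) (endAlgRat Ψ) = 1 := by
  obtain ⟨d, hd⟩ := hX.exists_sq_eq_finrank_centerField_endAlgRat
  haveI := isScalarTower_rat₃ hX
  haveI := nontrivial_endAlgRat₃ Ψ
  haveI : Module.Finite (centerField Ψ hX) (endAlgRat Ψ) :=
    Module.Finite.of_restrictScalars_finite ℚ (centerField Ψ hX) (endAlgRat Ψ)
  have hdvd := hX.finrank_centerField_mul_finrank_dvd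
  rw [hg] at hdvd
  have hm : 0 < finrank (centerField Ψ hX) (endAlgRat Ψ) := finrank_pos
  have hmdvd : finrank (centerField Ψ hX) (endAlgRat Ψ) ∣ 6 :=
    dvd_trans (Dvd.intro_left _ rfl) hdvd
  have hm6 := Nat.le_of_dvd (by norm_num) hmdvd
  have hd2 : d ≤ 2 := by nlinarith
  interval_cases d
  · omega
  · omega
  · rw [← hd] at hmdvd
    norm_num at hmdvd

/-- **The endomorphism algebra and the Picard number of a SIMPLE abelian threefold** (Lange's table at
`g = 3`): `F = End_ℚ(X) = K` is a field (Step I by counting), EITHER totally real with `e = [K:ℚ] ∣ 3`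
(type I, `ρ = e`): `(ρ, dim_ℚ End_ℚ X) ∈ {(1, 1), (3, 3)}`, OR a CM field with `e₀ ∣ 3` (type IV,
`ρ = e₀ d² = e₀`): `(ρ, dim_ℚ End_ℚ X) ∈ {(1, 2), (3, 6)}`.
[cite: Lange2023AbelianVarietiesComplex, §2.6.1 Proposition (table, columns `ρ`, «restriction», with `g = 3`)] [cite: MumfordAV1970, §21 Thm. 2 and table] -/
theorem IsSimple.finrank_neronSeveriGroup_of_finrank_eq_three (hX : IsSimple Ψ) (hη : IsRiemannForm Ψ η)
    (hg : finrank ℂ E = 3) :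
    (finrank ℤ (neronSeveriGroup Ψ) = 1 ∧ finrank ℚ (endAlgRat Ψ) = 1) ∨
      (finrank ℤ (neronSeveriGroup Ψ) = 3 ∧ finrank ℚ (endAlgRat Ψ) = 3) ∨
      (finrank ℤ (neronSeveriGroup Ψ) = 1 ∧ finrank ℚ (endAlgRat Ψ) = 2) ∨
      (finrank ℤ (neronSeveriGroup Ψ) = 3 ∧ finrank ℚ (endAlgRat Ψ) = 6) := by
  haveI := isScalarTower_rat₃ hX
  haveI := nontrivial_endAlgRat₃ Ψ
  have h1 := hX.finrank_centerField_endAlgRat_eq_one_of_finrank_eq_three hg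
  have hF : finrank ℚ (endAlgRat Ψ) = finrank ℚ (centerField Ψ hX) := by
    rw [← Module.finrank_mul_finrank ℚ (centerField Ψ hX) (endAlgRat Ψ), h1, mul_one]
  obtain ⟨G, hG⟩ := hη.exists_ratMatrix_latticeGram
  rcases hX.centerField_isTotallyReal_or_isCMField hη with hK | hK
  · haveI := hK
    have hI := hX.isAlbertTypeI_rosatiEnd_of_comm hη hG (hX.mul_comm_of_finrank_eq_one h1)
    have hρ := hX.finrank_neronSeveriGroup_of_isAlbertTypeI hη hG hI
    have hedvd : finrank ℚ (centerField Ψ hX) ∣ 3 := hg ▸ hX.finrank_centerField_dvd_of_isTotallyReal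
    have he3 := Nat.le_of_dvd (by norm_num) hedvd
    have he : 0 < finrank ℚ (centerField Ψ hX) := finrank_pos
    rw [hρ, hF]
    interval_cases (finrank ℚ (centerField Ψ hX)) <;> simp_all
  · haveI := hK
    have hIV := hX.isAlbertTypeIV_rosatiEnd hη hG
    have hρ := hX.finrank_neronSeveriGroup_of_isAlbertTypeIV hη hG hIV
    have he2 := hX.finrank_centerField_eq_two_mul
    have he0 : finrank ℚ (maximalRealSubfield (centerField Ψ hX)) ∣ 3 :=
      hg ▸ hX.finrank_maximalRealSubfield_centerField_dvd
    have he0le := Nat.le_of_dvd (by norm_num) he0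
    have he0pos : 0 < finrank ℚ (maximalRealSubfield (centerField Ψ hX)) := finrank_pos
    rw [hρ, hF, h1, mul_one, he2]
    interval_cases (finrank ℚ (maximalRealSubfield (centerField Ψ hX))) <;> simp_all

end Threefold

/-! ## §H2 Isotypic factors of dimension `9` and `R_9` -/

section Nine

variable {E : Type*} [NormedAddCommGroup E] [NormedSpace ℂ E]

/-- The covering space of a complex torus is finite-dimensional over `ℂ`. [folklore] -/
private theorem finiteDimensional_complex_of_period₉ {ι : Type*} [Fintype ι] (Φ : (ι → ℝ) ≃L[ℝ] E) :
    FiniteDimensional ℂ E := by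
  haveI : FiniteDimensional ℝ E := LinearEquiv.finiteDimensional Φ.toLinearEquiv
  exact Module.Finite.of_restrictScalars_finite ℝ ℂ E

/-- **Isotypic factors of dimension `9`**: `X` simple abelian, `n · dim X = 9` ⇒
`ρ(Xⁿ) ≤ 18 ∨ ρ(Xⁿ) ∈ {27, 45, 81}` (`(dim X, n) = (9,1)`: `ρ ≤ 18`; `(3,3)`: `3ρ + 3e ∈ {6, 18, 9, 27}` by
the threefold table; `(1,9)`: `9 + 36e ∈ {45, 81}`).
[cite: HulekLaface2019PicardNumbersAV, §6.2 (algorithm (ii)) with §2.2 Cor. 2.5] [cite: Lange2023AbelianVarietiesComplex, §2.6.1 Proposition (table, `g = 3`)] -/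
theorem IsSimple.finrank_neronSeveriGroup_pow_of_mul_finrank_eq_nine {ι : Type} [Fintype ι] [DecidableEq ι]
    [Nonempty ι] {X : (ι → ℝ) ≃L[ℝ] E} (hX : IsSimple X) (hA : IsAbelianVariety X) {n : ℕ} (hn : 0 < n)
    (hm : n * finrank ℂ E = 9) :
    finrank ℤ (neronSeveriGroup (powPeriod X n)) ≤ 18 ∨ finrank ℤ (neronSeveriGroup (powPeriod X n)) = 27 ∨
      finrank ℤ (neronSeveriGroup (powPeriod X n)) = 45 ∨ finrank ℤ (neronSeveriGroup (powPeriod X n)) = 81 := by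
  haveI : FiniteDimensional ℂ E := finiteDimensional_complex_of_period₉ X
  have hρn : finrank ℤ (neronSeveriGroup (powPeriod X n)) =
      n * finrank ℤ (neronSeveriGroup X) + n.choose 2 * finrank ℚ (endAlgRat X) :=
    hA.finrank_neronSeveriGroup_pow n
  have hpe : finrank ℤ (neronSeveriGroup X) ≤ finrank ℚ (endAlgRat X) :=
    hA.finrank_neronSeveriGroup_le_finrank_endAlgRat
  have hed : finrank ℚ (endAlgRat X) ∣ 2 * finrank ℂ E := hX.finrank_endAlgRat_dvd_two_mul_finrank
  have he1 : 1 ≤ finrank ℚ (endAlgRat X) := one_le_finrank_endAlgRat X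
  have hp1 : finrank ℂ E = 1 → finrank ℤ (neronSeveriGroup X) = 1 := fun h ↦
    finrank_neronSeveriGroup_eq_one_of_finrank_eq_one X h
  have hp3 : finrank ℂ E = 3 →
      (finrank ℤ (neronSeveriGroup X) = 1 ∧ finrank ℚ (endAlgRat X) = 1) ∨
        (finrank ℤ (neronSeveriGroup X) = 3 ∧ finrank ℚ (endAlgRat X) = 3) ∨
        (finrank ℤ (neronSeveriGroup X) = 1 ∧ finrank ℚ (endAlgRat X) = 2) ∨
        (finrank ℤ (neronSeveriGroup X) = 3 ∧ finrank ℚ (endAlgRat X) = 6) := fun h ↦ by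
    obtain ⟨η, hη⟩ := hA
    exact hX.finrank_neronSeveriGroup_of_finrank_eq_three hη h
  have hdpos : 0 < finrank ℂ E := finrank_pos_of_nonempty X
  set p := finrank ℤ (neronSeveriGroup X) with hp
  set e := finrank ℚ (endAlgRat X) with he
  set d := finrank ℂ E with hd
  rw [hρn]
  have hn9 : n ≤ 9 := by nlinarith
  interval_cases n
  · have hd9 : d = 9 := by omega
    rw [hd9] at hed
    have := Nat.le_of_dvd (by norm_num) hed
    simp only [one_mul, show Nat.choose 1 2 = 0 by decide, zero_mul, add_zero]
    omega
  · omega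
  · have hd3 : d = 3 := by omega
    simp only [show Nat.choose 3 2 = 3 by decide]
    rcases hp3 hd3 with ⟨h1, h2⟩ | ⟨h1, h2⟩ | ⟨h1, h2⟩ | ⟨h1, h2⟩ <;> omega
  · omega
  · omega
  · omega
  · omega
  · omega
  · have hd1 : d = 1 := by omega
    rw [hd1] at hed
    have h2 := Nat.le_of_dvd (by norm_num) hed
    have h1 := hp1 hd1
    simp only [show Nat.choose 9 2 = 36 by decide]
    interval_cases e <;> omega

/-- **`R_9 = {1, …, 33} ∪ {35} ∪ {37, …, 42} ∪ {45} ∪ {50, …, 53} ∪ {65, 81}`** — the algorithm of §6.2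
at `g = 9` (step (iv) with `R_1, …, R_8` and the simple-threefold table; witnesses: `{1, …, 18}`
(Prop. 6.4), `R_8 + 1`, `42 = C(4,2) + 6²`, `45 = 3² + 6²`, `50 = 7² + 1`, `52 = C(3,2) + 7²`,
`53 = 2² + 7²`, `81 = 9²`). In particular `34, 36, 43, 44, 46, …, 49 ∉ R_9`; `45 = 3² + 6²` is attained.
[cite: HulekLaface2019PicardNumbersAV, §6.2 (algorithm (i)–(iv)) with Prop. 6.4, Remark 6.5 and §1 Thm. 1.1] -/
theorem picardNumbers_nine :
    picardNumbers 9 = Set.Icc 1 33 ∪ {35} ∪ Set.Icc 37 42 ∪ {45} ∪ Set.Icc 50 53 ∪ {65, 81} := by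
  ext x
  constructor
  · intro hx
    have hx81 := picardNumbers_subset_Icc (by norm_num : 1 ≤ 9) hx
    rw [Set.mem_Icc] at hx81
    obtain ⟨A, hA, rfl⟩ := hx
    have hS := hA.finrank_neronSeveriGroup_mem_of_pow_of_add (by rw [Module.finrank_fin_fun]; norm_num)
      {y | y ≤ 33 ∨ y = 35 ∨ (37 ≤ y ∧ y ≤ 42) ∨ y = 45 ∨ (50 ≤ y ∧ y ≤ 53) ∨ y = 65 ∨ y = 81}
      (fun κ _ _ _ F _ _ X hX hXab n hn hm ↦ by
        rw [Module.finrank_fin_fun] at hm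
        rcases hX.finrank_neronSeveriGroup_pow_of_mul_finrank_eq_nine hXab hn hm with h | h | h | h <;>
          simp only [Set.mem_setOf_eq] <;> omega)
      (fun m hm0 hm9 a ha b hb ↦ by
        rw [Module.finrank_fin_fun] at hm9 hb
        simp only [Set.mem_setOf_eq]
        interval_cases m
        · rw [picardNumbers_one] at ha; rw [picardNumbers_eight] at hb
          simp only [Set.mem_singleton_iff, Set.mem_union, Set.mem_Icc, Set.mem_insert_iff] at ha hb; omega
        · rw [picardNumbers_two] at ha; rw [picardNumbers_seven] at hb
          simp only [Set.mem_singleton_iff, Set.mem_union, Set.mem_Icc, Set.mem_insert_iff] at ha hb; omega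
        · rw [picardNumbers_three] at ha; rw [picardNumbers_six] at hb
          simp only [Set.mem_singleton_iff, Set.mem_union, Set.mem_Icc, Set.mem_insert_iff] at ha hb; omega
        · rw [picardNumbers_four] at ha; rw [picardNumbers_five] at hb
          simp only [Set.mem_singleton_iff, Set.mem_union, Set.mem_Icc, Set.mem_insert_iff] at ha hb; omega
        · rw [picardNumbers_five] at ha; rw [picardNumbers_four] at hb
          simp only [Set.mem_singleton_iff, Set.mem_union, Set.mem_Icc, Set.mem_insert_iff] at ha hb; omega
        · rw [picardNumbers_six] at ha; rw [picardNumbers_three] at hb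
          simp only [Set.mem_singleton_iff, Set.mem_union, Set.mem_Icc, Set.mem_insert_iff] at ha hb; omega
        · rw [picardNumbers_seven] at ha; rw [picardNumbers_two] at hb
          simp only [Set.mem_singleton_iff, Set.mem_union, Set.mem_Icc, Set.mem_insert_iff] at ha hb; omega
        · rw [picardNumbers_eight] at ha; rw [picardNumbers_one] at hb
          simp only [Set.mem_singleton_iff, Set.mem_union, Set.mem_Icc, Set.mem_insert_iff] at ha hb; omega)
    simp only [Set.mem_setOf_eq] at hS
    simp only [Set.mem_union, Set.mem_Icc, Set.mem_insert_iff, Set.mem_singleton_iff]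
    omega
  · have hsucc : ∀ y ∈ picardNumbers 8, y + 1 ∈ picardNumbers 9 := fun y hy ↦
      image_succ_picardNumbers_subset 8 ⟨y, hy, rfl⟩
    have hR8 : ∀ y, y ∈ Set.Icc 1 32 ∪ {34} ∪ Set.Icc 36 40 ∪ ({50, 64} : Set ℕ) → y ∈ picardNumbers 8 :=
      fun y hy ↦ by rw [picardNumbers_eight]; exact hy
    rintro (((((hx | hx) | hx) | hx) | hx) | hx)
    · rw [Set.mem_Icc] at hx
      rcases Nat.lt_or_ge x 19 with h18 | h19
      · exact Icc_one_two_mul_subset_picardNumbers (g := 9) (by norm_num) (Set.mem_Icc.2 ⟨hx.1, by omega⟩)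
      · have h := hsucc (x - 1) (hR8 (x - 1) (Or.inl (Or.inl (Or.inl (Set.mem_Icc.2 ⟨by omega, by omega⟩)))))
        rwa [show x - 1 + 1 = x by omega] at h
    · rw [Set.mem_singleton_iff] at hx
      subst hx
      exact hsucc 34 (hR8 34 (by simp))
    · rw [Set.mem_Icc] at hx
      rcases Nat.lt_or_ge x 42 with h41 | h42
      · have h := hsucc (x - 1) (hR8 (x - 1) (Or.inl (Or.inr (Set.mem_Icc.2 ⟨by omega, by omega⟩))))
        rwa [show x - 1 + 1 = x by omega] at h
      · have hx42 : x = 42 := by omega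
        subst hx42
        simpa [show Nat.choose 4 2 = 6 by decide] using
          choose_add_sum_sq_mem_picardNumbers (S := Unit) (fun _ ↦ 6) 3
    · rw [Set.mem_singleton_iff] at hx
      subst hx
      simpa using choose_add_sum_sq_mem_picardNumbers (S := Bool) (fun b ↦ cond b 3 6) 0
    · rw [Set.mem_Icc] at hx
      rcases (show x = 50 ∨ x = 51 ∨ x = 52 ∨ x = 53 by omega) with rfl | rfl | rfl | rfl
      · simpa using sq_add_one_mem_picardNumbers_add (k := 2) (by norm_num) 7
      · exact hsucc 50 (hR8 50 (by simp))
      · simpa [show Nat.choose 3 2 = 3 by decide] using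
          choose_add_sum_sq_mem_picardNumbers (S := Unit) (fun _ ↦ 7) 2
      · simpa using choose_add_sum_sq_mem_picardNumbers (S := Bool) (fun b ↦ cond b 2 7) 0
    · rcases hx with rfl | hx
      · exact hsucc 64 (hR8 64 (by simp))
      · rw [Set.mem_singleton_iff] at hx
        subst hx
        simpa using choose_add_sum_sq_mem_picardNumbers (S := Unit) (fun _ ↦ 9) 0

end Nine

end ComplexTorus

end Literature.Geometry.Kaehler

end
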